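import Mathlib
import Literature.Computation.Certificates.LinearODETaylorCertificate
import HarnessLib

/-!
# Kernel-checkable analytic continuation of linear second-order ODEs, III: soundness of a stage

Topic `Literature/Computation/Certificates` (namespace `Literature.Computation.Certificates.LinearODE`).
`Equation.stage_sound`: if `stageCheck c st = true` then for EVERY `(y, y′)` solving the equation on an open interval
containing `c` and `c + h`, `(y, y′)(c + h) = y(c) S¹ + y′(c) S² + e` with `|eᵢ| ≤ |y(c)| τ₁ + |y′(c)| τ₂`
(`S¹, S², τ₁, τ₂` = the exact outputs of `stageOut`). Proof: the summed series `ordSol` with the data `(y(c), y′(c))`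
solves the equation on the disc (`IsOrdinaryPointData.hasDerivAt_ordSol`), coincides with `(y, y′)` there by uniqueness
for linear equations (`LinearSecondOrder.eqOn_of_solution_Ioo` [cite: Hartman2002, Ch. IV Lemma 1.1]), is the
superposition of the two basis series (`ordSol_linear`), and each basis series is its exact partial sum up to the certified
tail (`norm_ordSol_sub_sum_le`) [cite: Henrici1974, §3.6 eqs. (3.6-10)–(3.6-13)]. No axioms beyond the standard three,
no `sorry`.

## References
* P. Henrici, *Applied and Computational Complex Analysis*, Vol. 1, Wiley 1974: §1.2 (formal power series, the division
  recursion (1.2-2)), §2.3 Lemma 2.3f (majorant of the reciprocal), §3.6 (numerical analytic continuation along an arc,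
  eqs. (3.6-10)–(3.6-13)). Key `Henrici1974`.
* E. A. Coddington, N. Levinson, *Theory of Ordinary Differential Equations*, McGraw–Hill 1955, Ch. 3 §8 (linear
  equations with analytic coefficients), Ch. 4 §3 (the majorant method). Key `CoddingtonLevinson1955`.
* P. Hartman, *Ordinary Differential Equations*, SIAM Classics 38 (2002), Ch. IV §1 Lemma 1.1 (uniqueness), §12 (12.12)
  (undetermined coefficients). Key `Hartman2002`.
* M. Neher, *Geometric series bounds for the local errors of Taylor methods for linear n-th order ODEs*, in
  Alefeld–Rohn–Rump–Yamamoto (eds.), Symbolic Algebraic Methods and Verification Methods, Springer 2001, 183–193.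
  Key `Neher2001`.
* M. Mezzarobba, *Truncation bounds for differentially finite series*, Ann. Henri Lebesgue 2 (2019) 99–148. Key
  `Mezzarobba2019`; *Rigorous multiple-precision evaluation of D-finite functions in SageMath*, ICMS 2016,
  arXiv:1607.01967. Key `Mezzarobba2016`.
* R. E. Moore, *Interval Analysis*, Prentice–Hall 1966, §3.2 (rounded rational arithmetic). Key `Moore1966`.

PRINTED PRIOR ART (located by certnum-lit-2, FRESHNESS §3.12): the scheme — Cauchy-estimate coefficient bounds, the
recursion, a threshold («recess condition») beyond which the geometric bound propagates, the tail `A ω^k/(1 − ω)`, the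
derivative row — is Neher's interval Taylor method for linear ODEs [cite: Neher2001, Thm 1, Cor 1–2; §4.1; §5.2 (12)–(13)]
(there in PASCAL-XSC interval arithmetic; the inequalities here are self-derived for the `2 × 2` system and checked by the
Lean kernel in exact rationals); cf. Mezzarobba's rigorous D-finite continuation [cite: Mezzarobba2019, Prop 5.5, Alg 6.1]
[cite: Mezzarobba2016, §3–4] (Arb ball arithmetic). New here: the certificate is replayed INSIDE a proof kernel.
-/

open Finset Polynomial Set
open Literature.Analysis.ODE

namespace Literature.Computation.Certificates

namespace LinearODE

namespace Equation

variable (E : Equation)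

/-! ### Soundness of one stage (uniqueness form) -/

/-- **SOUNDNESS OF A STAGE.** If `stageCheck c st = true` then for EVERY pair `(y, y′)` solving
`P₂ y″ + P₁ y′ + P₀ y = 0` (in the solved form `y″ = 𝔭 y′ + 𝔮 y`) on an open interval containing `c` and `c + h`:
`(y, y′)(c + h) = y(c) · S¹ + y′(c) · S² + e` with `|e₁|, |e₂| ≤ |y(c)| τ₁ + |y′(c)| τ₂`, where `S¹, S², τ₁, τ₂` are the
exact rational outputs of `stageOut` (analytic continuation by one Taylor step with a certified remainder; the solution
is identified with the summed series by uniqueness for linear equations, `LinearSecondOrder.eqOn_of_solution_Ioo`).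
[cite: Henrici1974, §3.6 eqs. (3.6-10)–(3.6-13)] [cite: CoddingtonLevinson1955, Ch. 3 §8 and Ch. 4 §3] -/
theorem stage_sound {c : ℚ} {st : Stage} (hc : E.stageCheck c st = true) {α β : ℝ} {y y' : ℝ → ℝ}
    (hy : E.IsSolOn y y' (Ioo α β)) (hcJ : (c : ℝ) ∈ Ioo α β) (hchJ : ((c + st.h : ℚ) : ℝ) ∈ Ioo α β) :
    |y ((c + st.h : ℚ) : ℝ) - (y c * (E.stageOut c st).S1.1 + y' c * (E.stageOut c st).S2.1)| ≤
        |y c| * (E.stageOut c st).τ1 + |y' c| * (E.stageOut c st).τ2 ∧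
      |y' ((c + st.h : ℚ) : ℝ) - (y c * (E.stageOut c st).S1.2 + y' c * (E.stageOut c st).S2.2)| ≤
        |y c| * (E.stageOut c st).τ1 + |y' c| * (E.stageOut c st).τ2 := by
  obtain ⟨hdata, hP2⟩ := E.isOrdinaryPointData_of_check hc
  have hB1 := E.norm_ordCoeff_le_of_check hc (1, 0)
  have hB2 := E.norm_ordCoeff_le_of_check hc (0, 1)
  have hc' := hc
  simp only [stageCheck, Bool.and_eq_true, decide_eq_true_eq] at hc'
  obtain ⟨⟨⟨⟨⟨⟨⟨⟨-, -⟩, hρ⟩, -⟩, hμ⟩, hN⟩, hhρ⟩, hμh⟩, -⟩ := hc'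
  -- abbreviations
  set pt : ℕ → ℝ := fun k => ratTaylorCoeff (toPolyR (E.N1L c st.U)) (toPolyR (E.DL c st.U)) k
  set qt : ℕ → ℝ := fun k => ratTaylorCoeff (toPolyR (E.N0L c st.U)) (toPolyR (E.DL c st.U)) k
  set Pt : ℝ → ℝ := fun x => (toPolyR E.P1).eval (x + c) / (toPolyR E.P2).eval (x + c)
  set Qt : ℝ → ℝ := fun x => (toPolyR E.P0).eval (x + c) / (toPolyR E.P2).eval (x + c)
  set B1 : ℝ := ((bmaxQ (E.jetL c st (1, 0)) st.mu (st.N - 1) : ℚ) : ℝ)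
  set B2 : ℝ := ((bmaxQ (E.jetL c st (0, 1)) st.mu (st.N - 1) : ℚ) : ℝ)
  simp only [Rat.cast_one, Rat.cast_zero] at hB1 hB2
  have hρR : (0 : ℝ) < st.rho := by exact_mod_cast hρ
  have hμR : (st.rho : ℝ)⁻¹ < st.mu := by exact_mod_cast hμ
  have hμ0 : (0 : ℝ) < st.mu := lt_trans (inv_pos.2 hρR) hμR
  have hhρR : |(st.h : ℝ)| < st.rho := by exact_mod_cast hhρ
  have hμhR : (st.mu : ℝ) * |(st.h : ℝ)| < 1 := by exact_mod_cast hμh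
  -- the data of the given solution at the centre and its coefficient bound
  set s₀ : ℝ := y c
  set s₁ : ℝ := y' c
  have hBs : ∀ n, ‖ordCoeff pt qt s₀ s₁ n‖ ≤ (|s₀| * B1 + |s₁| * B2) * (st.mu : ℝ) ^ n := by
    intro n
    rw [ordCoeff_linear pt qt s₀ s₁ n]
    calc ‖s₀ • ordCoeff pt qt 1 0 n + s₁ • ordCoeff pt qt 0 1 n‖
        ≤ ‖s₀ • ordCoeff pt qt 1 0 n‖ + ‖s₁ • ordCoeff pt qt 0 1 n‖ := norm_add_le _ _
      _ ≤ |s₀| * (B1 * (st.mu : ℝ) ^ n) + |s₁| * (B2 * (st.mu : ℝ) ^ n) := by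
          rw [norm_smul, norm_smul, Real.norm_eq_abs, Real.norm_eq_abs]
          exact add_le_add (mul_le_mul_of_nonneg_left (hB1 n) (abs_nonneg _))
            (mul_le_mul_of_nonneg_left (hB2 n) (abs_nonneg _))
      _ = (|s₀| * B1 + |s₁| * B2) * (st.mu : ℝ) ^ n := by ring
  -- the series solution with these data solves the equation on the disc
  set r : ℝ := min (st.rho : ℝ) (st.mu : ℝ)⁻¹ with hr
  have hr0 : 0 < r := lt_min hρR (inv_pos.2 hμ0)
  have hdisc : ∀ x : ℝ, |x| < r → ‖x‖ < st.rho ∧ (st.mu : ℝ) * ‖x‖ < 1 := by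
    intro x hx
    rw [Real.norm_eq_abs]
    refine ⟨lt_of_lt_of_le hx (min_le_left _ _), ?_⟩
    calc (st.mu : ℝ) * |x| < st.mu * r := mul_lt_mul_of_pos_left hx hμ0
      _ ≤ st.mu * (st.mu : ℝ)⁻¹ := mul_le_mul_of_nonneg_left (min_le_right _ _) hμ0.le
      _ = 1 := mul_inv_cancel₀ hμ0.ne'
  set w : ℝ → ℝ := fun u => (ordSol pt qt s₀ s₁ (u - c)).1 with hw
  set w' : ℝ → ℝ := fun u => (ordSol pt qt s₀ s₁ (u - c)).2 with hw'
  set I : Set ℝ := Ioo (max α ((c : ℝ) - r)) (min β ((c : ℝ) + r)) with hI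
  have hIJ : I ⊆ Ioo α β := fun u hu => ⟨lt_of_le_of_lt (le_max_left _ _) hu.1, lt_of_lt_of_le hu.2 (min_le_left _ _)⟩
  have hIr : ∀ u ∈ I, |u - c| < r := fun u hu =>
    abs_sub_lt_iff.2 ⟨by linarith [lt_of_lt_of_le hu.2 (min_le_right _ _)],
      by linarith [lt_of_le_of_lt (le_max_right _ _) hu.1]⟩
  have hP2I : ∀ u ∈ I, (toPolyR E.P2).eval u ≠ 0 := by
    intro u hu
    have h := hP2 (u - c) (hdisc _ (hIr u hu)).1
    rwa [sub_add_cancel] at h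
  have hwsol : E.IsSolOn w w' I := by
    intro u hu
    obtain ⟨hx1, hx2⟩ := hdisc _ (hIr u hu)
    obtain ⟨hd1, hd2⟩ := hdata.hasDerivAt_ordSol hBs hμR.le hx1 hx2
    have hsub : HasDerivAt (fun z : ℝ => z - c) 1 u := (hasDerivAt_id u).sub_const _
    refine ⟨?_, ?_⟩
    · have h := hd1.comp u hsub
      rw [mul_one] at h
      exact h
    · have h := hd2.comp u hsub
      rw [mul_one] at h
      have e : -Qt (u - c) * (ordSol pt qt s₀ s₁ (u - c)).1 - Pt (u - c) * (ordSol pt qt s₀ s₁ (u - c)).2 =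
          E.pH u * w' u + E.qH u * w u := by
        simp only [hw, hw', Equation.pH, Equation.qH, Pt, Qt, sub_add_cancel]
        ring
      rw [e] at h
      exact h
  -- continuity of the coefficients on `I` and uniqueness
  have hcont : ContinuousOn E.pH I ∧ ContinuousOn E.qH I := by
    constructor
    · exact ((toPolyR E.P1).continuousOn.div (toPolyR E.P2).continuousOn hP2I).neg
    · exact ((toPolyR E.P0).continuousOn.div (toPolyR E.P2).continuousOn hP2I).neg
  have hcI : (c : ℝ) ∈ I := ⟨max_lt hcJ.1 (by linarith), lt_min hcJ.2 (by linarith)⟩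
  have hhr : |(st.h : ℝ)| < r := by
    refine lt_min hhρR ?_
    calc |(st.h : ℝ)| = (st.mu : ℝ)⁻¹ * ((st.mu : ℝ) * |(st.h : ℝ)|) := by
          rw [← mul_assoc, inv_mul_cancel₀ hμ0.ne', one_mul]
      _ < (st.mu : ℝ)⁻¹ * 1 := mul_lt_mul_of_pos_left hμhR (inv_pos.2 hμ0)
      _ = (st.mu : ℝ)⁻¹ := mul_one _
  have hcast : ((c + st.h : ℚ) : ℝ) = (c : ℝ) + (st.h : ℝ) := by push_cast; ring
  have hch : ((c + st.h : ℚ) : ℝ) ∈ I := by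
    rw [hcast]
    have h1 := (abs_lt.1 hhr).1
    have h2 := (abs_lt.1 hhr).2
    refine ⟨max_lt (hcast ▸ hchJ.1) (by linarith), lt_min (hcast ▸ hchJ.2) (by linarith)⟩
  obtain ⟨heq, heq'⟩ := eqOn_of_solution_Ioo (𝕜 := ℝ) hcont.1 hcont.2 hcI (fun t ht => hy t (hIJ ht)) hwsol
    (by simp [hw, s₀]) (by simp [hw', s₁])
  have hy1 : y ((c + st.h : ℚ) : ℝ) = (ordSol pt qt s₀ s₁ (st.h : ℝ)).1 := by
    rw [heq hch, hw]; simp only [hcast, add_sub_cancel_left]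
  have hy2 : y' ((c + st.h : ℚ) : ℝ) = (ordSol pt qt s₀ s₁ (st.h : ℝ)).2 := by
    rw [heq' hch, hw']; simp only [hcast, add_sub_cancel_left]
  -- superposition and the two tails
  have hxh : (st.mu : ℝ) * ‖(st.h : ℝ)‖ < 1 := by rwa [Real.norm_eq_abs]
  have hlin := ordSol_linear pt qt s₀ s₁ hB1 hB2 hμ0.le hxh
  have hjet1 : ∀ n < st.N, castPair ((E.jetL c st (1, 0)).getD n 0) = ordCoeff pt qt 1 0 n := by
    intro n hn
    have h := cast_jets (pt := E.ptL c st) (qt := E.qtL c st) (ptR := pt) (qtR := qt) 1 0 (st.N - 1)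
      (fun k hk => cast_divCoeffs _ _ (by omega)) (fun k hk => cast_divCoeffs _ _ (by omega)) n (by omega)
    simpa [jetL] using h
  have hjet2 : ∀ n < st.N, castPair ((E.jetL c st (0, 1)).getD n 0) = ordCoeff pt qt 0 1 n := by
    intro n hn
    have h := cast_jets (pt := E.ptL c st) (qt := E.qtL c st) (ptR := pt) (qtR := qt) 0 1 (st.N - 1)
      (fun k hk => cast_divCoeffs _ _ (by omega)) (fun k hk => cast_divCoeffs _ _ (by omega)) n (by omega)
    simpa [jetL] using h
  have hS1 : castPair (E.stageOut c st).S1 = ∑ n ∈ range st.N, (st.h : ℝ) ^ n • ordCoeff pt qt 1 0 n := by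
    rw [show (E.stageOut c st).S1 = psumQ (E.jetL c st (1, 0)) st.h st.N from rfl]
    exact castPair_psumQ hjet1 st.h
  have hS2 : castPair (E.stageOut c st).S2 = ∑ n ∈ range st.N, (st.h : ℝ) ^ n • ordCoeff pt qt 0 1 n := by
    rw [show (E.stageOut c st).S2 = psumQ (E.jetL c st (0, 1)) st.h st.N from rfl]
    exact castPair_psumQ hjet2 st.h
  have ht1 : ‖ordSol pt qt 1 0 (st.h : ℝ) - castPair (E.stageOut c st).S1‖ ≤ (E.stageOut c st).τ1 := by
    rw [hS1]
    refine (norm_ordSol_sub_sum_le pt qt 1 0 hB1 hμ0.le hxh st.N).trans (le_of_eq ?_)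
    rw [show (E.stageOut c st).τ1 = bmaxQ (E.jetL c st (1, 0)) st.mu (st.N - 1) *
      ((st.mu * |st.h|) ^ st.N / (1 - st.mu * |st.h|)) from rfl, Real.norm_eq_abs]
    push_cast
    ring
  have ht2 : ‖ordSol pt qt 0 1 (st.h : ℝ) - castPair (E.stageOut c st).S2‖ ≤ (E.stageOut c st).τ2 := by
    rw [hS2]
    refine (norm_ordSol_sub_sum_le pt qt 0 1 hB2 hμ0.le hxh st.N).trans (le_of_eq ?_)
    rw [show (E.stageOut c st).τ2 = bmaxQ (E.jetL c st (0, 1)) st.mu (st.N - 1) *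
      ((st.mu * |st.h|) ^ st.N / (1 - st.mu * |st.h|)) from rfl, Real.norm_eq_abs]
    push_cast
    ring
  -- assembly
  have e1 := norm_fst_le (ordSol pt qt 1 0 (st.h : ℝ) - castPair (E.stageOut c st).S1)
  have e2 := norm_fst_le (ordSol pt qt 0 1 (st.h : ℝ) - castPair (E.stageOut c st).S2)
  have e1' := norm_snd_le (ordSol pt qt 1 0 (st.h : ℝ) - castPair (E.stageOut c st).S1)
  have e2' := norm_snd_le (ordSol pt qt 0 1 (st.h : ℝ) - castPair (E.stageOut c st).S2)
  rw [Prod.fst_sub, castPair_fst, Real.norm_eq_abs] at e1 e2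
  rw [Prod.snd_sub, castPair_snd, Real.norm_eq_abs] at e1' e2'
  constructor
  · rw [hy1, hlin]
    calc |(s₀ • ordSol pt qt 1 0 (st.h : ℝ) + s₁ • ordSol pt qt 0 1 (st.h : ℝ)).1 -
            (s₀ * ((E.stageOut c st).S1.1 : ℝ) + s₁ * ((E.stageOut c st).S2.1 : ℝ))|
        = |s₀ * ((ordSol pt qt 1 0 (st.h : ℝ)).1 - (E.stageOut c st).S1.1) +
            s₁ * ((ordSol pt qt 0 1 (st.h : ℝ)).1 - (E.stageOut c st).S2.1)| := by
          congr 1; simp only [Prod.fst_add, Prod.smul_fst, smul_eq_mul]; ring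
      _ ≤ |s₀| * |(ordSol pt qt 1 0 (st.h : ℝ)).1 - (E.stageOut c st).S1.1| +
            |s₁| * |(ordSol pt qt 0 1 (st.h : ℝ)).1 - (E.stageOut c st).S2.1| := by
          refine (abs_add_le _ _).trans ?_; rw [abs_mul, abs_mul]
      _ ≤ |s₀| * (E.stageOut c st).τ1 + |s₁| * (E.stageOut c st).τ2 :=
          add_le_add (mul_le_mul_of_nonneg_left (e1.trans ht1) (abs_nonneg _))
            (mul_le_mul_of_nonneg_left (e2.trans ht2) (abs_nonneg _))
  · rw [hy2, hlin]
    calc |(s₀ • ordSol pt qt 1 0 (st.h : ℝ) + s₁ • ordSol pt qt 0 1 (st.h : ℝ)).2 -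
            (s₀ * ((E.stageOut c st).S1.2 : ℝ) + s₁ * ((E.stageOut c st).S2.2 : ℝ))|
        = |s₀ * ((ordSol pt qt 1 0 (st.h : ℝ)).2 - (E.stageOut c st).S1.2) +
            s₁ * ((ordSol pt qt 0 1 (st.h : ℝ)).2 - (E.stageOut c st).S2.2)| := by
          congr 1; simp only [Prod.snd_add, Prod.smul_snd, smul_eq_mul]; ring
      _ ≤ |s₀| * |(ordSol pt qt 1 0 (st.h : ℝ)).2 - (E.stageOut c st).S1.2| +
            |s₁| * |(ordSol pt qt 0 1 (st.h : ℝ)).2 - (E.stageOut c st).S2.2| := by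
          refine (abs_add_le _ _).trans ?_; rw [abs_mul, abs_mul]
      _ ≤ |s₀| * (E.stageOut c st).τ1 + |s₁| * (E.stageOut c st).τ2 :=
          add_le_add (mul_le_mul_of_nonneg_left (e1'.trans ht1) (abs_nonneg _))
            (mul_le_mul_of_nonneg_left (e2'.trans ht2) (abs_nonneg _))

end Equation

end LinearODE

end Literature.Computation.Certificates
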